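import Summits.RiemannHypothesis.RiemannHypothesis.Theorems.Splittings.ScrewNullCombNodes

/-!
# Splittings — SCREW NULL COMBINATIONS IX: NNC unconditionally

Cell rh-split (brief sha16 f79c5f09d8bcb036), seat rh-split-typer-2 g3 (prover; own initiative «NNC WITHOUT FOZ» on the cross/screw
column, lead GO HOME/INBOX.md 03:41:07Z, checkpoints 03:51Z/03:58Z/04:09Z/04:2xZ): the series SCREW NULL COMBINATIONS I–VI
(`ScrewNullCombUniqueness` … `ScrewNullCombination`) proved NNC = «no non-zero finite real combination
`t ↦ Σ_{j<n} z_j G_g(t, log(j+2))` of sections of Suzuki's screw kernel vanishes at every node `log(i+2)`» GIVEN finitely many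
off-line zeros (`nnc_of_finite_offline`).  Parts VII–IX remove that hypothesis: NNC holds outright (`ScrewNullCombUnconditional.nnc`).
This file is part IX, the assembly: `eq_zero_of_R_vanish` — the Landau–Gonek ending of part V with the off-line residue `K₁ = 0`
(if `R_z(ρ−½) = 0` at EVERY non-trivial zero then `z = 0`: for each `k` sum `m(ρ)(k+2)^{ρ−½}R_z(ρ−½) = 0` over `|Im ρ| ≤ T`; every
cross term is `O(T)` by Landau–Gonek, the diagonal is `z_k Σ_{|Im ρ|≤T} m(ρ) ≥ z_k N(T)`, and `N(T)/T → ∞`), and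
**`nnc`**: NO non-zero finite real combination of screw-kernel sections vanishes at every node — the binder `hnnc` of
`ScrewBridgeRigidity.fozNonsingular_of_nnc` / `etail_iff_foz_of_indexTransfer_nnc` discharged with NO hypothesis on the zeros
(part VI's `nnc_of_finite_offline` assumed finitely many off-line zeros; `ScrewBridgeRigidity.nnc_of_rh` assumed RH).  [new]

HONEST LABEL: RH-free and FOZ-free analysis of Suzuki's screw kernel at the integer nodes (inputs: the tree's ζ-growth bounds,
`riemannZeta_residue_one`, Suzuki's series (1.9) as landed in part III, Landau–Gonek and Riemann–von Mangoldt as landed in part V);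
it concerns the CONDITIONAL bridge bookkeeping of cell rh-split («SPLITTING SEARCH over kernel-typed RH-EQUIVALENCES; a splitting
A ∧ B ⟹ RH is CONDITIONAL bookkeeping unless A and B are both proved») and nothing here bears on the truth of RH.
-/

set_option linter.dupNamespace false

noncomputable section

namespace Summit.RiemannHypothesis.RiemannHypothesis.Theorems.Splittings.ScrewNullComb

open Filter Topology Complex Finset Set
open Literature.NumberTheory.LFunctions

/-- **Landau–Gonek ending, all zeros.** If the real combination `R_z(w) = Σ_j z_j (1 − (j+2)^{−w})` vanishes at
`w = ρ − ½` for EVERY non-trivial zero `ρ`, then `z = 0`.  Proof: for each `k`, sum `m(ρ)(k+2)^{ρ−½} R_z(ρ−½) = 0` over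
`|Im ρ| ≤ T`; by Landau–Gonek every cross term is `O(T)` except the diagonal `j = k`, which is `z_k · Σ_{|Im ρ|≤T} m(ρ)
≥ z_k N(T)`; since `N(T)/T → ∞`, `z_k = 0` (the proof of `eq_zero_of_R_vanish_online` with off-line residue `K₁ = 0`).
[folklore; Landau–Gonek + Riemann–von Mangoldt, both tree theorems] -/
theorem eq_zero_of_R_vanish (n : ℕ) (z : Fin n → ℝ)
    (hR : ∀ ρ : ℂ, ρ ∈ ZetaZeros.riemannZetaNontrivialZeros →
      ∑ j : Fin n, (z j : ℂ) * (1 - Complex.exp (-((ρ - 1 / 2) * (Real.log (((j : ℕ) + 2 : ℕ) : ℝ) : ℂ)))) = 0) :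
    z = 0 := by
  classical
  funext k
  by_contra hk
  -- notation
  set u : Fin n → ℝ := fun j ↦ Real.log (((j : ℕ) + 2 : ℕ) : ℝ) with hu
  set g : ℂ → ℂ := fun ρ ↦ (riemannZetaZeroOrder ρ : ℂ) * (Complex.exp ((ρ - 1 / 2) * (u k : ℂ)) *
      ∑ j : Fin n, (z j : ℂ) * (1 - Complex.exp (-((ρ - 1 / 2) * (u j : ℂ))))) with hg
  set S : ℝ → ℂ := fun T ↦ ∑ ρ ∈ (weilZeroIndex_finite T).toFinset,
      (riemannZetaZeroOrder ρ : ℂ) * Complex.exp ((ρ - 1 / 2) * (u k : ℂ)) with hS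
  set P : Fin n → ℝ → ℂ := fun j T ↦ ∑ ρ ∈ (weilZeroIndex_finite T).toFinset,
      (riemannZetaZeroOrder ρ : ℂ) * Complex.exp ((ρ - 1 / 2) * ((u k - u j : ℝ) : ℂ)) with hP
  set Ntot : ℝ → ℝ := fun T ↦ ∑ ρ ∈ (weilZeroIndex_finite T).toFinset, (riemannZetaZeroOrder ρ : ℝ) with hNtot
  -- (a) every zero term vanishes: `Σ g = 0` (so the former off-line residue `K₁` is `0`)
  have hR' : ∀ ρ : ℂ, ρ ∈ ZetaZeros.riemannZetaNontrivialZeros →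
      ∑ j : Fin n, (z j : ℂ) * (1 - Complex.exp (-((ρ - 1 / 2) * (u j : ℂ)))) = 0 := fun ρ h1 ↦ hR ρ h1
  set K₁ : ℝ := 0 with hK₁
  have hga : ∀ T : ℝ, ‖∑ ρ ∈ (weilZeroIndex_finite T).toFinset, g ρ‖ ≤ K₁ := by
    intro T
    rw [hK₁, Finset.sum_eq_zero fun ρ hρ ↦ ?_, norm_zero]
    rw [Set.Finite.mem_toFinset, weilZeroIndex_eq_inter] at hρ
    simp only [hg, hR' ρ hρ.1, mul_zero]
  -- (b) Landau–Gonek constants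
  have hxk1 : (1 : ℝ) < (((k : ℕ) + 2 : ℕ) : ℝ) := by exact_mod_cast (show 1 < (k : ℕ) + 2 by omega)
  obtain ⟨CS, hCS⟩ := exists_landau_bound_shift hxk1
  have hSb : ∀ T : ℝ, 2 ≤ T → ‖S T‖ ≤ CS * T := by
    intro T hT
    have e : S T = ∑ ρ ∈ (weilZeroIndex_finite T).toFinset,
        (riemannZetaZeroOrder ρ : ℂ) * ((((k : ℕ) + 2 : ℕ) : ℝ) : ℂ) ^ (ρ - 1 / 2) := by
      refine Finset.sum_congr rfl fun ρ _ ↦ ?_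
      rw [hu]; simp only
      rw [exp_mul_log_eq_cpow (by positivity)]
    rw [e]; exact hCS T hT
  have hPb : ∀ j : Fin n, ∃ C : ℝ, ∀ T : ℝ, 2 ≤ T → j ≠ k → ‖P j T‖ ≤ C * T := by
    intro j
    by_cases hjk : j = k
    · exact ⟨0, fun T _ hne ↦ absurd hjk hne⟩
    · obtain ⟨C, hC⟩ := exists_pair_bound k j hjk
      exact ⟨C, fun T hT _ ↦ hC T hT⟩
  choose CP hCP using hPb
  -- (c) the identity `z_k · Ntot = (Σ z_j) S − Σ_{j ≠ k} z_j P_j − Σ g`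
  have hPk : ∀ T : ℝ, P k T = (Ntot T : ℂ) := by
    intro T
    simp only [hP, hNtot]
    push_cast
    refine Finset.sum_congr rfl fun ρ _ ↦ ?_
    rw [sub_self, mul_zero, Complex.exp_zero, mul_one]
  have hid : ∀ T : ℝ, ∑ ρ ∈ (weilZeroIndex_finite T).toFinset, g ρ =
      (∑ j : Fin n, (z j : ℂ)) * S T - ∑ j : Fin n, (z j : ℂ) * P j T := by
    intro T
    have e1 : ∀ ρ : ℂ, g ρ = ∑ j : Fin n, (z j : ℂ) * ((riemannZetaZeroOrder ρ : ℂ) *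
        Complex.exp ((ρ - 1 / 2) * (u k : ℂ)) - (riemannZetaZeroOrder ρ : ℂ) *
          Complex.exp ((ρ - 1 / 2) * ((u k - u j : ℝ) : ℂ))) := by
      intro ρ
      simp only [hg]
      rw [Finset.mul_sum, Finset.mul_sum]
      refine Finset.sum_congr rfl fun j _ ↦ ?_
      have : Complex.exp ((ρ - 1 / 2) * ((u k - u j : ℝ) : ℂ)) =
          Complex.exp ((ρ - 1 / 2) * (u k : ℂ)) * Complex.exp (-((ρ - 1 / 2) * (u j : ℂ))) := by
        rw [← Complex.exp_add]; push_cast; ring_nf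
      rw [this]; ring
    simp_rw [e1]
    rw [Finset.sum_comm, Finset.sum_mul, ← Finset.sum_sub_distrib]
    refine Finset.sum_congr rfl fun j _ ↦ ?_
    simp only [hS, hP]
    rw [Finset.mul_sum, Finset.mul_sum, ← Finset.sum_sub_distrib]
    exact Finset.sum_congr rfl fun ρ _ ↦ by ring
  have hsplitk : ∀ T : ℝ, ∑ j : Fin n, (z j : ℂ) * P j T =
      (z k : ℂ) * (Ntot T : ℂ) + ∑ j ∈ Finset.univ.erase k, (z j : ℂ) * P j T := by
    intro T
    rw [← Finset.add_sum_erase _ _ (Finset.mem_univ k), hPk]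
  -- (d) norms: `|z_k| Ntot T ≤ K₂ T + K₁` for `T ≥ 2`
  set K₂ : ℝ := (∑ j : Fin n, |z j|) * CS + ∑ j ∈ Finset.univ.erase k, |z j| * CP j with hK₂
  have hNtot0 : ∀ T, 0 ≤ Ntot T := fun T ↦ Finset.sum_nonneg fun ρ hρ ↦ by
    rw [Set.Finite.mem_toFinset] at hρ
    exact_mod_cast riemannZetaZeroOrder_nonneg (ne_one_of_riemannZeta_eq_zero hρ.1)
  have hbound : ∀ T : ℝ, 2 ≤ T → |z k| * Ntot T ≤ K₂ * T + K₁ := by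
    intro T hT
    have e : (z k : ℂ) * (Ntot T : ℂ) = (∑ j : Fin n, (z j : ℂ)) * S T -
        ∑ j ∈ Finset.univ.erase k, (z j : ℂ) * P j T - ∑ ρ ∈ (weilZeroIndex_finite T).toFinset, g ρ := by
      rw [hid T, hsplitk T]; ring
    have hn : |z k| * Ntot T = ‖(z k : ℂ) * (Ntot T : ℂ)‖ := by
      rw [norm_mul, Complex.norm_real, Complex.norm_real, Real.norm_eq_abs, Real.norm_eq_abs,
        abs_of_nonneg (hNtot0 T)]
    rw [hn, e]
    have h1 : ‖(∑ j : Fin n, (z j : ℂ)) * S T‖ ≤ (∑ j : Fin n, |z j|) * CS * T := by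
      rw [norm_mul, mul_assoc]
      refine mul_le_mul ?_ (hSb T hT) (norm_nonneg _) (Finset.sum_nonneg fun _ _ ↦ abs_nonneg _)
      refine (norm_sum_le _ _).trans (le_of_eq (Finset.sum_congr rfl fun j _ ↦ ?_))
      rw [Complex.norm_real, Real.norm_eq_abs]
    have h2 : ‖∑ j ∈ Finset.univ.erase k, (z j : ℂ) * P j T‖ ≤ (∑ j ∈ Finset.univ.erase k, |z j| * CP j) * T := by
      rw [Finset.sum_mul]
      refine (norm_sum_le _ _).trans (Finset.sum_le_sum fun j hj ↦ ?_)
      rw [norm_mul, Complex.norm_real, Real.norm_eq_abs, mul_assoc]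
      exact mul_le_mul_of_nonneg_left (hCP j T hT (Finset.ne_of_mem_erase hj)) (abs_nonneg _)
    have h3 := hga T
    calc ‖(∑ j : Fin n, (z j : ℂ)) * S T - ∑ j ∈ Finset.univ.erase k, (z j : ℂ) * P j T -
          ∑ ρ ∈ (weilZeroIndex_finite T).toFinset, g ρ‖
        ≤ ‖(∑ j : Fin n, (z j : ℂ)) * S T‖ + ‖∑ j ∈ Finset.univ.erase k, (z j : ℂ) * P j T‖ +
            ‖∑ ρ ∈ (weilZeroIndex_finite T).toFinset, g ρ‖ := by
          have := norm_sub_le ((∑ j : Fin n, (z j : ℂ)) * S T - ∑ j ∈ Finset.univ.erase k, (z j : ℂ) * P j T)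
            (∑ ρ ∈ (weilZeroIndex_finite T).toFinset, g ρ)
          have := norm_sub_le ((∑ j : Fin n, (z j : ℂ)) * S T) (∑ j ∈ Finset.univ.erase k, (z j : ℂ) * P j T)
          linarith
      _ ≤ (∑ j : Fin n, |z j|) * CS * T + (∑ j ∈ Finset.univ.erase k, |z j| * CP j) * T + K₁ := by linarith
      _ = K₂ * T + K₁ := by rw [hK₂]; ring
  -- (e) contradiction with `N(T)/T → ∞`
  have hzk : 0 < |z k| := abs_pos.2 hk
  have hev := LatticeUncertainty.eventually_mul_le_zetaZeroCount ((K₂ + |K₁| + 1) / |z k|)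
  obtain ⟨T, hT⟩ := (hev.and (eventually_ge_atTop (2 : ℝ))).exists
  obtain ⟨hNT, hT2⟩ := hT
  have hN' : (zetaZeroCount T : ℝ) ≤ Ntot T := zetaZeroCount_le_sum T
  have h1 : (K₂ + |K₁| + 1) / |z k| * T * |z k| ≤ |z k| * Ntot T := by
    have := mul_le_mul_of_nonneg_right (hNT.trans hN') hzk.le
    linarith [this]
  have h2 : (K₂ + |K₁| + 1) / |z k| * T * |z k| = (K₂ + |K₁| + 1) * T := by field_simp
  have h3 := hbound T hT2
  have h4 : K₁ ≤ |K₁| := le_abs_self _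
  have h5 : |K₁| ≤ |K₁| * T := le_mul_of_one_le_right (abs_nonneg _) (by linarith)
  have h6 : (K₂ + |K₁| + 1) * T ≤ K₂ * T + K₁ := by rw [← h2]; exact h1.trans h3
  nlinarith

/-- **NNC, unconditionally.**  NO non-zero finite real combination `t ↦ Σ_{j<n} z_j G_g(t, log(j+2))` of sections of
Suzuki's screw kernel `G_g(t,u) = Ψ(t) + Ψ(u) − Ψ(t−u)` vanishes at every node `t = log(i+2)`, `i ∈ ℕ` — with no
hypothesis on the zeros of `ζ` (compare `nnc_of_finite_offline`, which assumed finitely many off-line zeros).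
Proof: the node equations are the Dirichlet-series identities `Σ_ρ a(ρ) m^{ρ−½} = A₀` (`m ≥ 1`) for
`a(ρ) = m(ρ)(ρ−½)^{-2} R_z(ρ−½)`; the uniqueness theorem `coeff_eq_zero_of_nodes` (analytic continuation of
`Σ_ρ a(ρ)ζ(s−(ρ−½)) = A₀ζ(s)` to boxes right of `Re s = ½`, pole comparison) kills every `a(ρ)`, and Landau–Gonek
(`eq_zero_of_R_vanish`) gives `z = 0`.  RH-free and FOZ-free. [new] -/
theorem nnc (n : ℕ) (z : Fin n → ℝ)
    (hz : ∀ i : ℕ, ∑ j : Fin n, zetaScrewKernel (Real.log ((i + 2 : ℕ) : ℝ))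
        (Real.log (((j : ℕ) + 2 : ℕ) : ℝ)) * z j = 0) : z = 0 :=
  eq_zero_of_R_vanish n z fun ρ hρ ↦ R_eq_zero_of_nodes n z hz ρ hρ

end Summit.RiemannHypothesis.RiemannHypothesis.Theorems.Splittings.ScrewNullComb

end
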